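import Literature.AlgebraicGeometry.Motives.AbelianVarietyFGSubfieldDescentEnd
import Literature.AlgebraicGeometry.Motives.CartierDivisorClassPullback
import Literature.AlgebraicGeometry.Limits.CartierDivisorDescent
import HarnessLib

/-!
# An abelian variety with finitely many endomorphisms AND A CARTIER DIVISOR is defined over a finitely generated subfield
# (EGA IV₃ 8.8.2 + Stacks 0B8W (2); Milne, AV §20)

Topic `Literature/AlgebraicGeometry/Motives`; namespace `Literature.AlgebraicGeometry.Motives.AbelianVariety`.  ONE THEOREM
(no definition, no instance, no notation, no named fact, no `sorry`).  Sequel of ★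
`Motives/AbelianVarietyFGSubfieldDescentEnd` (`exists_finset_intermediateField_descent_end`: `(A, r i)` over `k′` descends to
every intermediate field containing a finite set), carrying ONE Cartier divisor `Θ` through the SAME finite-stage model:
**`exists_finset_intermediateField_descent_end_divisor`** — there is a finite `s ⊆ k′` such that for every intermediate field
`k₁ ⊇ s` there are `A₁ / k₁`, `e : A₁ ⊗ k′ ≅ A`, `r₁ i` with `(r₁ i)_{k′} ≫ e = e ≫ r i`, AND a Cartier divisor `Θ₁` on `A₁` with
`e^* Θ ∼ Θ₁ ⊗ k′` (linear equivalence of the class pull-backs ★ `CartierDivisor.classPullback` along `e` and along the base-change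
projection `(A₁ ⊗ k′) → A₁`).

Proof: the proof of ★ `exists_finset_intermediateField_descent_end` VERBATIM (model `P / k₀`, limit `P_{k′} = lim_t P ⊗ k₀[t]`
over the finitely generated subalgebras, ★ `SubalgGrpSpread`), plus: `Θ` read on the limit comes from a stage
(★ `Limits.exists_sameDivisor_pullback_π` = Stacks 0B8W (2) on the cone ★ `SubalgApprox.prodCone`/`isLimitProdCone`, as in
★ `Motives/TheoremOfCubeLimitProofs`), the common stage also dominates the divisor stage, `Θ₁ :=` the stage divisor pulled back to
`P₁ = P_t ⊗_{k₀[t]} k₁`, and the comparison is class-level bookkeeping (★ `classPullback_comp_linEquiv`, `LinEquiv.classPullback`,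
`classPullback_linEquiv_pullback`, ★ `pullbackFacObjIso_hom_left_whiskerLeft` / `_hom_left_fst`).

Cell `hodgecm-mathlib` (D-0151), (L3) road F1 (B-p03 (g17) census `CENSUS-L3-RigidityAnyField` §1 (D1)+(D2); B-plan1 (g16) 06:52:14Z):
the input «descend `(B, e, Θ)` to a countable algebraically closed subfield» of «triples are rigid over any field».  Nothing here is
about HC by itself; HC_CM is proved only modulo the 7 printed citations until rung 0 closes.

## References
* A. Grothendieck, EGA IV₃ (Publ. Math. IHÉS 28, 1966), Thm. 8.8.2. [EGAIV3]
* The Stacks project, Tag 0B8W (2) (Picard groups / Cartier divisors of limits), Tag 01ZM. [StacksProject]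
* J. S. Milne, *Abelian Varieties*, in Cornell–Silverman (1986), §20, proof of Cor. 20.4 and Rem. 20.9. [Milne1986AbelianVarieties]
-/

noncomputable section

open CategoryTheory CategoryTheory.Limits AlgebraicGeometry MonoidalCategory
  CartesianMonoidalCategory MonObj
open scoped TensorProduct

universe u v

namespace Literature.AlgebraicGeometry.Motives

set_option backward.isDefEq.respectTransparency false

namespace AbelianVariety

open Literature.AlgebraicGeometry.Limits

/-- Elements of a ring of finite type over `ℤ` map into any subfield containing the images of a
generating set. Routine. [folklore] -/
private theorem range_subset_subfield_of_adjoin_eq_top'' {R₀ k' : Type u} [CommRing R₀] [Field k']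
    (ψ : R₀ →+* k') (s₀ : Finset R₀) (hs₀ : Algebra.adjoin ℤ (s₀ : Set R₀) = ⊤) (k₁ : Subfield k')
    (h : ∀ x ∈ s₀, ψ x ∈ k₁) : ∀ x : R₀, ψ x ∈ k₁ := by
  intro x
  have hx : x ∈ Algebra.adjoin ℤ (s₀ : Set R₀) := by rw [hs₀]; trivial
  induction hx using Algebra.adjoin_induction with
  | mem y hy => exact h y hy
  | algebraMap n => rw [eq_intCast, map_intCast]; exact intCast_mem k₁ n
  | add y z _ _ hy hz => rw [map_add]; exact add_mem hy hz
  | mul y z _ _ hy hz => rw [map_mul]; exact mul_mem hy hz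

-- heartbeat budget: the ★ template needs `maxHeartbeats 400000`; the divisor bookkeeping is added inside the same proof.
set_option maxHeartbeats 800000 in
/-- **An abelian variety together with finitely many endomorphisms and a Cartier divisor is defined over a finitely generated
subfield** (EGA IV₃ Thm. 8.8.2 for `(A, r)`; Stacks 0B8W (2) for the divisor): for `A / k′ ⊇ F`, `r : J → End A` finite and a Cartier
divisor `Θ` on `A`, there is a finite `s ⊆ k′` such that for every intermediate field `F ⊆ k₁ ⊆ k′` containing `s` there are an
abelian variety `A₁ / k₁`, an isomorphism of abelian varieties `e : A₁ ×_{k₁} k′ ≅ A`, endomorphisms `r₁ i` with `(r₁ i)_{k′} ≫ e = e ≫ r i`,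
and a Cartier divisor `Θ₁` on `A₁` with `e^*Θ ∼ (A₁ ×_{k₁} k′ → A₁)^* Θ₁` (linear equivalence of class pull-backs).
[cite: EGAIV3, Thm. 8.8.2] [cite: StacksProject, Tag 0B8W] [cite: Milne1986AbelianVarieties, §20, proof of Cor. 20.4 and Rem. 20.9] -/
theorem exists_finset_intermediateField_descent_end_divisor {F : Type u} [Field F] {k' : Type u} [Field k']
    [Algebra F k'] (A : AbelianVariety k') [IsIntegral A.X.left] {J : Type v} [Finite J] (r : J → (A ⟶ A))
    (Θ : CartierDivisor A.X.left) :
    ∃ s : Finset k', ∀ k₁ : IntermediateField F k', (↑s : Set k') ⊆ k₁ →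
      ∃ (A₁ : AbelianVariety k₁) (e : A₁.baseChange k' ≅ A) (r₁ : J → (A₁ ⟶ A₁))
        (_ : IsIntegral A₁.X.left) (_ : IsIntegral (A₁.baseChange k').X.left) (Θ₁ : CartierDivisor A₁.X.left),
        (∀ i, Hom.baseChange k' (r₁ i) ≫ e.hom = e.hom ≫ r i) ∧
        (Θ.classPullback e.hom.hom.hom.hom.left).LinEquiv
          (Θ₁.classPullback (pullback.fst A₁.X.hom (Spec.map (CommRingCat.ofHom (algebraMap k₁ k'))))) := by
  classical
  -- (1) the scheme `A` descends to a finitely generated ring `R₀ ↪ k'`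
  haveI : LocallyOfFiniteType A.X.hom := A.isProper.toLocallyOfFiniteType
  obtain ⟨R₀, _, ψ, X', p', π, hft, _, hψ, hsep, hlft, hqc, hsq⟩ :=
    exists_isPullback_specMap_of_isNoetherianRing A.X.hom
  haveI := hsep; haveI := hlft; haveI := hqc
  obtain ⟨s₀, hs₀⟩ := Algebra.FiniteType.out (R := ℤ) (A := R₀)
  -- the subfield `k₀ ⊆ k'` generated by `R₀`, and `P = X' ×_{R₀} k₀`
  let k₀ : Subfield k' := Subfield.closure (Set.range ψ)
  have hψk₀ : ∀ x, ψ x ∈ k₀ := fun x => Subfield.subset_closure ⟨x, rfl⟩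
  let ψ₀ : R₀ →+* k₀ := ψ.codRestrict k₀ hψk₀
  have hψ₀ : (algebraMap k₀ k').comp ψ₀ = ψ := RingHom.ext fun _ => rfl
  let i₀ : Spec (.of (k₀ : Type u)) ⟶ Spec (.of R₀) := Spec.map (CommRingCat.ofHom ψ₀)
  let P : SchemeOver (k₀ : Type u) := (Over.pullback i₀).obj (Over.mk p')
  -- the cover `j : Spec k' → Spec k₀` and `P ⊗_{k₀} k' ≅ A.X`
  let j : Spec (.of k') ⟶ Spec (.of (k₀ : Type u)) :=
    Spec.map (CommRingCat.ofHom (algebraMap k₀ k'))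
  have hj : j ≫ i₀ = Spec.map (CommRingCat.ofHom ψ) := by
    rw [← Spec.map_comp, ← CommRingCat.ofHom_comp, hψ₀]
  let χ : A.X ≅ (Over.pullback (Spec.map (CommRingCat.ofHom ψ))).obj (Over.mk p') :=
    Over.isoMk hsq.isoPullback (hsq.isoPullback_hom_snd)
  let PB : SchemeOver k' := SubalgGrpSpread.limObj k' P
  have φ' : A.X ≅ PB :=
    χ ≪≫ (pullbackFacObjIso i₀ j (Spec.map (CommRingCat.ofHom ψ)) hj (Over.mk p')).symm
  -- (2) transport the group structure; spread it AND the endomorphisms out to a common stage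
  letI instPB : GrpObj PB := GrpObj.ofIso φ'
  haveI : QuasiCompact P.hom := MorphismProperty.pullback_snd _ _ hqc
  haveI : IsSeparated P.hom := MorphismProperty.pullback_snd _ _ hsep
  haveI : LocallyOfFiniteType P.hom := MorphismProperty.pullback_snd _ _ hlft
  haveI : LocallyOfFinitePresentation P.hom := inferInstance
  haveI : Flat P.hom := inferInstance
  haveI : QuasiSeparated P.hom := inferInstance
  obtain ⟨t₀, ⟨d₀⟩⟩ := SubalgGrpSpread.exists_grpSpread k' (∅ : Finset k') P
  -- the endomorphisms on `P ⊗_{k₀} k'`, as `k₀`-morphisms `P ⊗ Spec k' → P`, spread to stages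
  let ρ : J → (PB ⟶ PB) := fun i => φ'.inv ≫ (r i).hom.hom.hom ≫ φ'.hom
  have hsp : ∀ i, ∃ (τ : (SubalgApprox.Idx k' (∅ : Finset k'))ᵒᵖ)
      (g : P ⊗ (SubalgApprox.baseDiagram (k₀ : Type u) k' ∅).obj τ ⟶ P),
      (P ◁ SubalgGrpSpread.baseLeg (k₀ : Type u) k' ∅ τ) ≫ g =
        unsliceHom (specOver (k₀ : Type u) k') (ρ i) :=
    fun i => SubalgGrpSpread.exists_whiskerLeft_comp_eq k' ∅ P _
  choose τ g hg using hsp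
  -- (2′) THE DIVISOR: `Θ` read on the limit `PB = lim_t P_t` comes from a stage `tΘ` (Stacks 0B8W (2))
  haveI : IsIntegral PB.left := IsIntegral.of_isIso φ'.hom.left
  haveI : IsIntegral (SubalgApprox.prodCone (k₀ : Type u) k' (∅ : Finset k') P).pt := ‹IsIntegral PB.left›
  have hbc₀ : IsPullback (pullback.fst P.hom (specOver (k₀ : Type u) k').hom) PB.hom P.hom
      (specOver (k₀ : Type u) k').hom := IsPullback.of_hasPullback P.hom (specOver (k₀ : Type u) k').hom
  haveI : GeometricallyIntegral PB.hom := by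
    have e1 : PB.hom = φ'.inv.left ≫ A.X.hom := (Over.w φ'.inv).symm
    rw [e1]
    haveI : IsIso φ'.inv.left := inferInstanceAs (IsIso ((Over.forget _).mapIso φ'.symm).hom)
    exact (MorphismProperty.cancel_left_of_respectsIso @GeometricallyIntegral φ'.inv.left
      A.X.hom).mpr A.geometricallyIntegral
  haveI : GeometricallyIntegral P.hom :=
    geometricallyIntegral_of_isPullback_of_field k' PB.hom
      (pullback.fst P.hom (specOver (k₀ : Type u) k').hom) P.hom hbc₀
  haveI : Quiver.IsThin (SubalgApprox.Idx k' (∅ : Finset k'))ᵒᵖ :=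
    fun _ _ => ⟨fun f g => SubalgApprox.hom_eq f g⟩
  let D' : CartierDivisor (SubalgApprox.prodCone (k₀ : Type u) k' (∅ : Finset k') P).pt :=
    Θ.classPullback φ'.inv.left
  obtain ⟨tΘ, EΘ, hEΘ⟩ := exists_sameDivisor_pullback_π (SubalgApprox.prodDiagram (k₀ : Type u) k' ∅ P)
    (SubalgApprox.prodCone (k₀ : Type u) k' ∅ P) (SubalgApprox.isLimitProdCone (k₀ : Type u) k' ∅ P) D'
  -- a common stage `t` for the group law, all the `r i`, and the divisor
  obtain ⟨t, ht⟩ := SubalgApprox.exists_hom_of_finite k' (∅ : Finset k')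
    (fun o : Option (Option J) => o.elim tΘ fun o' => o'.elim t₀ τ)
  let σΘ : t ⟶ tΘ := (ht none).some
  let σ₀ : t ⟶ t₀ := (ht (some none)).some
  let σ : ∀ i, t ⟶ τ i := fun i => (ht (some (some i))).some
  let d : SubalgGrpSpread.GrpSpread k' ∅ P t := d₀.restrict σ₀
  let T := (SubalgApprox.baseDiagram (k₀ : Type u) k' (∅ : Finset k')).obj t
  let g' : ∀ i, P ⊗ T ⟶ P :=
    fun i => (P ◁ (SubalgApprox.baseDiagram (k₀ : Type u) k' ∅).map (σ i)) ≫ g i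
  have hg' : ∀ i, (P ◁ SubalgGrpSpread.baseLeg (k₀ : Type u) k' ∅ t) ≫ g' i =
      unsliceHom (specOver (k₀ : Type u) k') (ρ i) := fun i => by
    rw [← MonoidalCategory.whiskerLeft_comp_assoc,
      show SubalgGrpSpread.baseLeg (k₀ : Type u) k' ∅ t ≫
          (SubalgApprox.baseDiagram (k₀ : Type u) k' ∅).map (σ i) =
        SubalgGrpSpread.baseLeg (k₀ : Type u) k' ∅ (τ i) from
        (SubalgApprox.baseCone (k₀ : Type u) k' ∅).w (σ i)]
    exact hg i
  -- the group structure on the (flat, separated) stage `P_t`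
  haveI : Flat (SubalgGrpSpread.stageObj k' ∅ P t).hom :=
    inferInstanceAs (Flat (pullback.snd P.hom T.hom))
  haveI : IsSeparated (SubalgGrpSpread.stageObj k' ∅ P t).hom :=
    inferInstanceAs (IsSeparated (pullback.snd P.hom T.hom))
  letI Gt : GrpObj (SubalgGrpSpread.stageObj k' ∅ P t) := d.grpObj
  have hmon := d.isMonHom_legFacObjIso_hom
  -- (3) the finite set: generators of `R₀` and the stage `t`
  refine ⟨s₀.image ψ ∪ t.unop.1, fun k₁ hk₁ => ?_⟩
  -- `R₀ ⊆ k₁`, `k₀ ⊆ k₁`, `k₀[t] ⊆ k₁`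
  have hψk₁ : ∀ x, ψ x ∈ k₁ :=
    range_subset_subfield_of_adjoin_eq_top'' ψ s₀ hs₀ k₁.toSubfield fun x hx =>
      hk₁ (Finset.mem_union_left _ (Finset.mem_image_of_mem ψ hx))
  have hk₀k₁ : k₀ ≤ k₁.toSubfield := Subfield.closure_le.mpr (by rintro _ ⟨x, rfl⟩; exact hψk₁ x)
  let St : Subalgebra k₀ k' := SubalgApprox.sub k₀ k' t.unop.1
  let k₁' : Subalgebra k₀ k' :=
    { carrier := (k₁ : Set k')
      mul_mem' := fun ha hb => k₁.mul_mem ha hb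
      one_mem' := k₁.one_mem
      add_mem' := fun ha hb => k₁.add_mem ha hb
      zero_mem' := k₁.zero_mem
      algebraMap_mem' := fun c => (hk₀k₁ c.2 : (c : k') ∈ k₁.toSubfield) }
  have hSt : St ≤ k₁' := Algebra.adjoin_le fun x hx => hk₁ (Finset.mem_union_right _ hx)
  let ρk : St →+* k₁ := St.val.toRingHom.codRestrict k₁ fun x => hSt x.2
  have hρk : (algebraMap k₁ k').comp ρk = St.val.toRingHom := RingHom.ext fun _ => rfl
  -- (4) base change of the stage group scheme to `k₁`
  let jρ : Spec (.of (k₁ : Type u)) ⟶ T.left := Spec.map (CommRingCat.ofHom ρk)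
  let P₁ : SchemeOver (k₁ : Type u) := (Over.pullback jρ).obj (SubalgGrpSpread.stageObj k' ∅ P t)
  letI G₁ : GrpObj P₁ :=
    Functor.grpObjObj (F := Over.pullback jρ) (G := SubalgGrpSpread.stageObj k' ∅ P t)
  -- `P₁ ⊗_{k₁} k' ≅ A.X` over `k'`, AS GROUP OBJECTS
  let j₁ : Spec (.of k') ⟶ Spec (.of (k₁ : Type u)) :=
    Spec.map (CommRingCat.ofHom (algebraMap k₁ k'))
  have hleg : j₁ ≫ jρ = (SubalgGrpSpread.baseLeg (k₀ : Type u) k' ∅ t).left := by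
    rw [SubalgApprox.baseCone_π_app_left, ← Spec.map_comp, ← CommRingCat.ofHom_comp, hρk]
    rfl
  let Xg : Grp (Over T.left) := Grp.mk (SubalgGrpSpread.stageObj k' ∅ P t)
  let F1 : (Over.pullback j₁).obj P₁ ≅
      (SubalgGrpSpread.legPullback (k₀ : Type u) k' ∅ t).obj (SubalgGrpSpread.stageObj k' ∅ P t) :=
    pullbackFacObjIso jρ j₁ _ hleg (SubalgGrpSpread.stageObj k' ∅ P t)
  let F2 := SubalgGrpSpread.legFacObjIso k' ∅ t P
  -- the underlying `k'`-isomorphism of schemes `P₁ ⊗_{k₁} k' ≅ A.X`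
  let ψ₁ : (Literature.AlgebraicGeometry.Motives.baseChange (k₁ : Type u) k').obj P₁ ≅ A.X :=
    F1 ≪≫ F2 ≪≫ φ'.symm
  -- … which underlies an isomorphism of group objects
  obtain ⟨E₀, hE₀, hE₀'⟩ : ∃ E₀ : (Over.pullback j₁).mapGrp.obj ((Over.pullback jρ).mapGrp.obj Xg) ≅ A.toGrp,
      E₀.hom.hom.hom = ψ₁.hom ∧ E₀.inv.hom.hom = ψ₁.inv := by
    let I1 : (Over.pullback j₁).mapGrp.obj ((Over.pullback jρ).mapGrp.obj Xg) ≅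
        (SubalgGrpSpread.legPullback (k₀ : Type u) k' ∅ t).mapGrp.obj Xg :=
      ((Functor.mapGrpCompIso (F := Over.pullback jρ) (G := Over.pullback j₁)).symm ≪≫
        Functor.mapGrpNatIso
          (pullbackFacIso jρ j₁ (SubalgGrpSpread.baseLeg (k₀ : Type u) k' ∅ t).left hleg)).app Xg
    let I2 : (SubalgGrpSpread.legPullback (k₀ : Type u) k' ∅ t).mapGrp.obj Xg ≅ Grp.mk PB :=
      @Grp.mkIso' _ _ _ _ _ F2
        (Functor.grpObjObj (F := SubalgGrpSpread.legPullback (k₀ : Type u) k' ∅ t)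
          (G := SubalgGrpSpread.stageObj k' ∅ P t)) instPB hmon
    let I3 : Grp.mk PB ≅ A.toGrp := (@Grp.mkIso' _ _ _ _ _ φ' A.grpObj instPB (isMonHom_ofIso φ')).symm
    refine ⟨I1 ≪≫ I2 ≪≫ I3, ?_, ?_⟩
    · simp only [I1, I2, I3, ψ₁, F1, Iso.trans_hom, Iso.symm_hom, Iso.app_hom, NatTrans.comp_app,
        Grp.comp_hom_hom, Functor.mapGrpCompIso_inv_app_hom_hom, Functor.mapGrpNatIso_hom_app_hom_hom,
        Grp.mkIso'_hom_hom_hom, Grp.mkIso'_inv_hom_hom, pullbackFacIso_hom_app]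
      rfl
    · simp only [I1, I2, I3, ψ₁, F1, Iso.trans_inv, Iso.symm_inv, Iso.app_inv, NatTrans.comp_app,
        Grp.comp_hom_hom, Functor.mapGrpCompIso_hom_app_hom_hom, Functor.mapGrpNatIso_inv_app_hom_hom,
        Grp.mkIso'_hom_hom_hom, Grp.mkIso'_inv_hom_hom, pullbackFacIso_inv_app, Category.assoc]
      rfl
  -- (5) properties of `P₁ → Spec k₁` by descent along `Spec k' → Spec k₁`
  have hbc : IsPullback (pullback.fst P₁.hom j₁)
      ((Literature.AlgebraicGeometry.Motives.baseChange (k₁ : Type u) k').obj P₁).hom P₁.hom j₁ :=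
    IsPullback.of_hasPullback P₁.hom j₁
  haveI : Surjective j₁ := (ProperDescent.fpqc_specMap (k₁ : Type u) k').1.1
  haveI : Flat j₁ := (ProperDescent.fpqc_specMap (k₁ : Type u) k').1.2
  haveI : IsProper ((Literature.AlgebraicGeometry.Motives.baseChange (k₁ : Type u) k').obj P₁).hom := by
    have e1 : ((Literature.AlgebraicGeometry.Motives.baseChange (k₁ : Type u) k').obj P₁).hom =
        ψ₁.hom.left ≫ A.X.hom := (Over.w ψ₁.hom).symm
    rw [e1]; infer_instance
  haveI : IsIso ψ₁.hom.left := inferInstanceAs (IsIso ((Over.forget _).mapIso ψ₁).hom)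
  haveI : GeometricallyIntegral
      ((Literature.AlgebraicGeometry.Motives.baseChange (k₁ : Type u) k').obj P₁).hom := by
    have e1 : ((Literature.AlgebraicGeometry.Motives.baseChange (k₁ : Type u) k').obj P₁).hom =
        ψ₁.hom.left ≫ A.X.hom := (Over.w ψ₁.hom).symm
    rw [e1]
    exact (MorphismProperty.cancel_left_of_respectsIso @GeometricallyIntegral ψ₁.hom.left
      A.X.hom).mpr A.geometricallyIntegral
  haveI : IsSeparated P₁.hom := LaurentSchroer2023.isSeparated_of_isPullback hbc.flip
  have hPr : IsProper P₁.hom := Morphisms.isProper_of_isPullback hbc.flip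
  have hGI : GeometricallyIntegral P₁.hom :=
    geometricallyIntegral_of_isPullback_of_field k'
      ((Literature.AlgebraicGeometry.Motives.baseChange (k₁ : Type u) k').obj P₁).hom
      (pullback.fst P₁.hom j₁) P₁.hom hbc
  -- (6) the abelian variety `A₁` and the isomorphism of abelian varieties `A₁ ×_{k₁} k' ≅ A`
  let A₁ : AbelianVariety (k₁ : Type u) :=
    { X := P₁, grpObj := G₁, isProper := hPr, geometricallyIntegral := hGI }
  let E : A₁.baseChange k' ≅ A := InducedCategory.isoMk E₀
  have hE : E.hom.hom.hom.hom = ψ₁.hom := hE₀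
  have hE' : E.inv.hom.hom.hom = ψ₁.inv := hE₀'
  -- (7) the endomorphisms descend: stage endomorphisms, base-changed to `k₁`
  let f₀ : ∀ i, P₁ ⟶ P₁ := fun i => (Over.pullback jρ).map (sliceHom T (g' i))
  have hf₀ : ∀ i, (bcFunctor (k₁ : Type u) k').map (f₀ i) = ψ₁.hom ≫ (r i).hom.hom.hom ≫ ψ₁.inv := by
    intro i
    -- through `F1`: naturality of the transitivity isomorphism
    have h1 : (Over.pullback j₁).map (f₀ i) =
        F1.hom ≫ (SubalgGrpSpread.legPullback (k₀ : Type u) k' ∅ t).map (sliceHom T (g' i)) ≫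
          F1.inv := by
      rw [← Category.assoc, Iso.eq_comp_inv]
      exact pullbackFacObjIso_naturality jρ j₁ _ hleg (sliceHom T (g' i))
    -- through `F2`: the dictionary commutes with base change, and `g' i` restricts to `ρ i`
    have h2 : (SubalgGrpSpread.legPullback (k₀ : Type u) k' ∅ t).map (sliceHom T (g' i)) =
        F2.hom ≫ ρ i ≫ F2.inv := by
      rw [← Category.assoc, Iso.eq_comp_inv]
      have e := pullback_map_sliceHom (SubalgGrpSpread.baseLeg (k₀ : Type u) k' ∅ t) (P := P) (g' i)
      rw [hg' i, sliceHom_unsliceHom] at e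
      exact e
    change (Over.pullback j₁).map (f₀ i) = _
    rw [h1, h2]
    simp only [ψ₁, ρ, Iso.trans_hom, Iso.trans_inv, Iso.symm_hom, Iso.symm_inv, Category.assoc]
  have hex : ∀ i, ∃ f : A₁ ⟶ A₁, Hom.baseChange k' f = E.hom ≫ r i ≫ E.inv := fun i =>
    exists_hom_baseChange_eq_of_map_eq k' (E.hom ≫ r i ≫ E.inv) (f₀ i) (by
      rw [hf₀ i, comp_hom, comp_hom, Grp.comp_hom_hom, Grp.comp_hom_hom, hE, hE'])
  choose r₁ hr₁ using hex
  -- (8) the divisor descends: `Θ₁ := (stage divisor)|_{P₁}` and `ε^*Θ ∼ Θ₁ ⊗ k'` in class form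
  haveI iPt : IsIntegral ((SubalgApprox.prodDiagram (k₀ : Type u) k' ∅ P).obj t) := inferInstance
  haveI : IsIntegral P₁.left := GeometricallyIntegral.isIntegral_of_subsingleton P₁.hom
  haveI iBC : IsIntegral ((Literature.AlgebraicGeometry.Motives.baseChange (k₁ : Type u) k').obj P₁).left :=
    IsIntegral.of_isIso ψ₁.inv.left
  haveI iBC' : IsIntegral ((Over.pullback j₁).obj P₁).left := iBC
  haveI : IsIntegral ((SubalgGrpSpread.legPullback (k₀ : Type u) k' ∅ t).obj
      (SubalgGrpSpread.stageObj k' ∅ P t)).left := IsIntegral.of_isIso F1.hom.left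
  let Et : CartierDivisor ((SubalgApprox.prodDiagram (k₀ : Type u) k' ∅ P).obj t) :=
    EΘ.pullback ((SubalgApprox.prodDiagram (k₀ : Type u) k' ∅ P).map σΘ)
  -- the projections `P₁ → P_t` and `(P_t)_{k'} → P_t`
  let bP : P₁.left ⟶ (SubalgApprox.prodDiagram (k₀ : Type u) k' ∅ P).obj t :=
    pullback.fst (SubalgGrpSpread.stageObj k' ∅ P t).hom jρ
  let qP : ((SubalgGrpSpread.legPullback (k₀ : Type u) k' ∅ t).obj (SubalgGrpSpread.stageObj k' ∅ P t)).left ⟶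
      (SubalgApprox.prodDiagram (k₀ : Type u) k' ∅ P).obj t :=
    pullback.fst (SubalgGrpSpread.stageObj k' ∅ P t).hom (SubalgGrpSpread.baseLeg (k₀ : Type u) k' ∅ t).left
  let Θ₁ : CartierDivisor P₁.left := Et.classPullback bP
  have hA₁bc : IsIntegral (A₁.baseChange k').X.left := iBC
  refine ⟨A₁, E, r₁, ‹IsIntegral P₁.left›, hA₁bc, Θ₁, fun i => ?_, ?_⟩
  · simp only [hr₁, Category.assoc, Iso.inv_hom_id, Category.comp_id]
  · -- `e.left = F1.left ≫ F2.left ≫ φ'⁻¹.left`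
    have heq : E.hom.hom.hom.hom.left = F1.hom.left ≫ F2.hom.left ≫ φ'.inv.left := by
      rw [hE]; rfl
    -- `F2.left ≫ π_t = qP` and `F1.left ≫ qP = pr ≫ bP`
    have hF2 : F2.hom.left ≫ proj (SubalgApprox.prodDiagram (k₀ : Type u) k' ∅ P)
        (SubalgApprox.prodCone (k₀ : Type u) k' ∅ P) t = qP :=
      pullbackFacObjIso_hom_left_whiskerLeft (SubalgGrpSpread.baseLeg (k₀ : Type u) k' ∅ t) P
    have hF1 : F1.hom.left ≫ qP =
        pullback.fst P₁.hom (Spec.map (CommRingCat.ofHom (algebraMap (k₁ : Type u) k'))) ≫ bP :=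
      pullbackFacObjIso_hom_left_fst jρ j₁ _ hleg (SubalgGrpSpread.stageObj k' ∅ P t)
    -- the stage relation on the limit: `D' ∼ π_t^* Et`
    have hw : proj (SubalgApprox.prodDiagram (k₀ : Type u) k' ∅ P) (SubalgApprox.prodCone (k₀ : Type u) k' ∅ P) tΘ =
        proj (SubalgApprox.prodDiagram (k₀ : Type u) k' ∅ P) (SubalgApprox.prodCone (k₀ : Type u) k' ∅ P) t ≫
          (SubalgApprox.prodDiagram (k₀ : Type u) k' ∅ P).map σΘ :=
      (proj_comp (SubalgApprox.prodDiagram (k₀ : Type u) k' ∅ P) (SubalgApprox.prodCone (k₀ : Type u) k' ∅ P) σΘ).symm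
    have h1 : D'.LinEquiv (Et.classPullback (proj (SubalgApprox.prodDiagram (k₀ : Type u) k' ∅ P)
        (SubalgApprox.prodCone (k₀ : Type u) k' ∅ P) t)) := by
      refine hEΘ.linEquiv.trans ?_
      refine (((EΘ.pullback_congr_sameDivisor hw).trans
        (EΘ.pullback_pullback_sameDivisor _ _).symm).linEquiv).trans ?_
      exact (Et.classPullback_linEquiv_pullback _).symm
    -- assemble
    rw [heq]
    refine (Θ.classPullback_comp_linEquiv _ _).trans ?_
    refine (((Θ.classPullback_comp_linEquiv _ _).classPullback _)).trans ?_
    refine ((h1.classPullback _).classPullback _).trans ?_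
    refine (((Et.classPullback_comp_linEquiv _ _).symm.classPullback _)).trans ?_
    rw [CartierDivisor.classPullback_congr hF2]
    refine ((Et.classPullback_comp_linEquiv _ _).symm).trans ?_
    rw [CartierDivisor.classPullback_congr hF1]
    exact Et.classPullback_comp_linEquiv _ _

end AbelianVariety

end Literature.AlgebraicGeometry.Motives

end
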